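import Mathlib
import Summits.PneNP.PneNP.Theorems.ClusUniversalCertificateCoordDefs

/-!
# Route ClusUniversalCertificate, crux `UniversalCertAll` — «max flats of products are products»

Support file for `stmt-PneNP-19683` (cell pnp-ideate, route `ClusUniversalCertificate`, rung F-N1; path `coord`, objects of record
`…CoordDefs.lean` p516754, namespace `…Theorems.ClusCoord`).  The structural fact behind every «tight on products / on `N^n` / on
`S × V_k`» line of the cell record (ROUND-5–7, lit ROUND-8 §Y) and behind the tensor-power remark (ROUND-6 §C6): the certificate codimension
is ADDITIVE on products.  For finite-dimensional `𝔽₂`-spaces `V₁, V₂` and `Y₁ ⊆ V₁`, `Y₂ ⊆ V₂`, `y₁ ∈ Y₁`, `y₂ ∈ Y₂`: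

  `fcodim (finrank V₁ + finrank V₂) (Y₁ ×ˢ Y₂) (y₁, y₂) = fcodim (finrank V₁) Y₁ y₁ + fcodim (finrank V₂) Y₂ y₂`

(`fcodim_product`), where `fcodim N Y y` is the `sInf`-codimension of the largest flat through `y` inside `Y` — literally `ClusCoord.acodim`
when `V = 𝔽₂^M`, `N = M` (`acodim_eq_fcodim`).  `≤`: the product of optimal flats (`AffineSubspace.mk' (y₁,y₂) (D₁.prod D₂)`); `≥`: a
flat inside `Y₁ ×ˢ Y₂` projects (`AffineSubspace.map` along `LinearMap.fst/snd`) to flats inside `Y₁`, `Y₂`, and its direction embeds into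
the product of the two projected directions.  Consequence (`dsum_product`): `D(Y₁ × Y₂) = |Y₂|·D(Y₁) + |Y₁|·D(Y₂)` for the total dimension
`D = Σ_y (N − fcodim)`.  Pure linear algebra; the crux and its conjecture are OPEN; FRONTIER rung F-N1 — nothing here bears on P vs NP.
-/

set_option linter.dupNamespace false -- `Summit.PneNP.PneNP.…`: summit = sub-problem name (D-0017 single-conjunct layout)

namespace Summit.PneNP.PneNP.Theorems.ClusCoordProduct

open Finset

variable {V₁ V₂ : Type*} [AddCommGroup V₁] [Module (ZMod 2) V₁] [AddCommGroup V₂] [Module (ZMod 2) V₂]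

/-- The certificate codimension in a general ambient space: the least `c` such that some flat through `y` inside `Y` has
`finrank ≥ N − c` (for `V = 𝔽₂^M`, `N = M` this is `ClusCoord.acodim`). -/
noncomputable def fcodim {V : Type*} [AddCommGroup V] [Module (ZMod 2) V] (N : ℕ) (Y : Finset V) (y : V) : ℕ :=
  sInf {c : ℕ | ∃ A : AffineSubspace (ZMod 2) V, y ∈ A ∧ (∀ z ∈ A, z ∈ Y) ∧ N ≤ Module.finrank (ZMod 2) A.direction + c}

/-- `ClusCoord.acodim` is `fcodim` on `𝔽₂^M`. -/
theorem acodim_eq_fcodim {M : ℕ} (Y : Finset (Fin M → ZMod 2)) (y : Fin M → ZMod 2) :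
    Summit.PneNP.PneNP.Theorems.ClusCoord.acodim M Y y = fcodim M Y y := rfl

/-- The defining set of `fcodim` is nonempty at a point of `Y` (the singleton flat). -/
theorem fcodim_set_nonempty {V : Type*} [AddCommGroup V] [Module (ZMod 2) V] (N : ℕ) (Y : Finset V) (y : V) (hy : y ∈ Y) :
    {c : ℕ | ∃ A : AffineSubspace (ZMod 2) V, y ∈ A ∧ (∀ z ∈ A, z ∈ Y) ∧ N ≤ Module.finrank (ZMod 2) A.direction + c}.Nonempty := by
  refine ⟨N, AffineSubspace.mk' y ⊥, AffineSubspace.self_mem_mk' _ _, ?_, by simp⟩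
  intro z hz
  rw [AffineSubspace.mem_mk'] at hz
  have : z = y := by
    rw [Submodule.mem_bot, vsub_eq_sub, sub_eq_zero] at hz
    exact hz
  rw [this]
  exact hy

/-- An optimal flat exists at every point of `Y`. -/
theorem exists_optimal_flat {V : Type*} [AddCommGroup V] [Module (ZMod 2) V] (N : ℕ) (Y : Finset V) (y : V) (hy : y ∈ Y) :
    ∃ A : AffineSubspace (ZMod 2) V, y ∈ A ∧ (∀ z ∈ A, z ∈ Y) ∧ N ≤ Module.finrank (ZMod 2) A.direction + fcodim N Y y :=
  Nat.sInf_mem (fcodim_set_nonempty N Y y hy)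

/-! ## Dimensions of products and projections of submodules -/

/-- `finrank (D₁.prod D₂) ≥ finrank D₁ + finrank D₂` (in fact equality; this direction suffices). -/
theorem finrank_add_le_finrank_prod [Module.Finite (ZMod 2) V₁] [Module.Finite (ZMod 2) V₂]
    (D₁ : Submodule (ZMod 2) V₁) (D₂ : Submodule (ZMod 2) V₂) :
    Module.finrank (ZMod 2) D₁ + Module.finrank (ZMod 2) D₂ ≤ Module.finrank (ZMod 2) (D₁.prod D₂) := by
  -- the injective map `D₁ × D₂ → D₁.prod D₂`
  let Φ : (D₁ × D₂) →ₗ[ZMod 2] (D₁.prod D₂) :=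
    { toFun := fun d => ⟨((d.1 : V₁), (d.2 : V₂)), Submodule.mem_prod.mpr ⟨d.1.2, d.2.2⟩⟩
      map_add' := fun a b => rfl
      map_smul' := fun c a => rfl }
  have hΦ : Function.Injective Φ := by
    rintro ⟨a₁, a₂⟩ ⟨b₁, b₂⟩ hab
    have h := congrArg (fun d : (D₁.prod D₂) => (d : V₁ × V₂)) hab
    simp only [Φ, LinearMap.coe_mk, AddHom.coe_mk] at h
    obtain ⟨h1, h2⟩ := Prod.mk.inj h
    exact Prod.ext (Subtype.ext h1) (Subtype.ext h2)
  have := LinearMap.finrank_le_finrank_of_injective hΦ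
  rw [Module.finrank_prod] at this
  exact this

/-- `finrank D ≤ finrank (D.map fst) + finrank (D.map snd)` for a submodule of a product. -/
theorem finrank_le_finrank_map_fst_add_snd [Module.Finite (ZMod 2) V₁] [Module.Finite (ZMod 2) V₂]
    (D : Submodule (ZMod 2) (V₁ × V₂)) :
    Module.finrank (ZMod 2) D ≤ Module.finrank (ZMod 2) (D.map (LinearMap.fst (ZMod 2) V₁ V₂)) +
      Module.finrank (ZMod 2) (D.map (LinearMap.snd (ZMod 2) V₁ V₂)) := by
  let Φ : D →ₗ[ZMod 2] (D.map (LinearMap.fst (ZMod 2) V₁ V₂)) × (D.map (LinearMap.snd (ZMod 2) V₁ V₂)) :=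
    { toFun := fun d => (⟨(d : V₁ × V₂).1, Submodule.mem_map_of_mem d.2⟩, ⟨(d : V₁ × V₂).2, Submodule.mem_map_of_mem d.2⟩)
      map_add' := fun a b => rfl
      map_smul' := fun c a => rfl }
  have hΦ : Function.Injective Φ := by
    intro a b hab
    simp only [Φ, LinearMap.coe_mk, AddHom.coe_mk, Prod.mk.injEq, Subtype.mk.injEq] at hab
    exact Subtype.ext (Prod.ext hab.1 hab.2)
  have := LinearMap.finrank_le_finrank_of_injective hΦ
  rw [Module.finrank_prod] at this
  exact this

/-! ## The product formula -/

/-- **`≤`: the product of optimal flats is a flat inside the product.** -/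
theorem fcodim_product_le [Module.Finite (ZMod 2) V₁] [Module.Finite (ZMod 2) V₂] [DecidableEq V₁] [DecidableEq V₂]
    (N₁ N₂ : ℕ) (Y₁ : Finset V₁) (Y₂ : Finset V₂) (y₁ : V₁) (y₂ : V₂) (hy₁ : y₁ ∈ Y₁) (hy₂ : y₂ ∈ Y₂) :
    fcodim (N₁ + N₂) (Y₁ ×ˢ Y₂) (y₁, y₂) ≤ fcodim N₁ Y₁ y₁ + fcodim N₂ Y₂ y₂ := by
  obtain ⟨A₁, hyA₁, hA₁Y, hd₁⟩ := exists_optimal_flat N₁ Y₁ y₁ hy₁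
  obtain ⟨A₂, hyA₂, hA₂Y, hd₂⟩ := exists_optimal_flat N₂ Y₂ y₂ hy₂
  refine Nat.sInf_le ⟨AffineSubspace.mk' (y₁, y₂) (A₁.direction.prod A₂.direction), AffineSubspace.self_mem_mk' _ _, ?_, ?_⟩
  · intro z hz
    rw [AffineSubspace.mem_mk', Submodule.mem_prod] at hz
    obtain ⟨h1, h2⟩ := hz
    rw [Finset.mem_product]
    constructor
    · have : z.1 = (z.1 - y₁) +ᵥ y₁ := by rw [vadd_eq_add, sub_add_cancel]
      rw [this]
      exact hA₁Y _ (AffineSubspace.vadd_mem_of_mem_direction h1 hyA₁)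
    · have : z.2 = (z.2 - y₂) +ᵥ y₂ := by rw [vadd_eq_add, sub_add_cancel]
      rw [this]
      exact hA₂Y _ (AffineSubspace.vadd_mem_of_mem_direction h2 hyA₂)
  · rw [AffineSubspace.direction_mk']
    have := finrank_add_le_finrank_prod A₁.direction A₂.direction
    omega

/-- **`≥`: a flat inside the product projects to flats inside the factors, and its dimension is at most the sum of theirs.** -/
theorem le_fcodim_product [Module.Finite (ZMod 2) V₁] [Module.Finite (ZMod 2) V₂] [DecidableEq V₁] [DecidableEq V₂]
    (Y₁ : Finset V₁) (Y₂ : Finset V₂) (y₁ : V₁) (y₂ : V₂) (hy₁ : y₁ ∈ Y₁) (hy₂ : y₂ ∈ Y₂) :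
    fcodim (Module.finrank (ZMod 2) V₁) Y₁ y₁ + fcodim (Module.finrank (ZMod 2) V₂) Y₂ y₂ ≤
      fcodim (Module.finrank (ZMod 2) V₁ + Module.finrank (ZMod 2) V₂) (Y₁ ×ˢ Y₂) (y₁, y₂) := by
  set N₁ := Module.finrank (ZMod 2) V₁ with hN₁
  set N₂ := Module.finrank (ZMod 2) V₂ with hN₂
  have hy : (y₁, y₂) ∈ Y₁ ×ˢ Y₂ := Finset.mem_product.mpr ⟨hy₁, hy₂⟩
  unfold fcodim
  apply le_csInf (fcodim_set_nonempty (N₁ + N₂) (Y₁ ×ˢ Y₂) (y₁, y₂) hy)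
  rintro c ⟨A, hyA, hAY, hdim⟩
  -- the two projections of `A`
  have h₁ : sInf {c : ℕ | ∃ B : AffineSubspace (ZMod 2) V₁, y₁ ∈ B ∧ (∀ z ∈ B, z ∈ Y₁) ∧
      N₁ ≤ Module.finrank (ZMod 2) B.direction + c} ≤
      N₁ - Module.finrank (ZMod 2) (A.direction.map (LinearMap.fst (ZMod 2) V₁ V₂)) := by
    apply Nat.sInf_le
    refine ⟨A.map (LinearMap.fst (ZMod 2) V₁ V₂).toAffineMap, ?_, ?_, ?_⟩
    · exact ⟨(y₁, y₂), hyA, rfl⟩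
    · rintro z ⟨w, hw, rfl⟩
      have := Finset.mem_product.mp (hAY w hw)
      exact this.1
    · rw [AffineSubspace.map_direction, LinearMap.toAffineMap_linear]
      omega
  have h₂ : sInf {c : ℕ | ∃ B : AffineSubspace (ZMod 2) V₂, y₂ ∈ B ∧ (∀ z ∈ B, z ∈ Y₂) ∧
      N₂ ≤ Module.finrank (ZMod 2) B.direction + c} ≤
      N₂ - Module.finrank (ZMod 2) (A.direction.map (LinearMap.snd (ZMod 2) V₁ V₂)) := by
    apply Nat.sInf_le
    refine ⟨A.map (LinearMap.snd (ZMod 2) V₁ V₂).toAffineMap, ?_, ?_, ?_⟩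
    · exact ⟨(y₁, y₂), hyA, rfl⟩
    · rintro z ⟨w, hw, rfl⟩
      have := Finset.mem_product.mp (hAY w hw)
      exact this.2
    · rw [AffineSubspace.map_direction, LinearMap.toAffineMap_linear]
      omega
  have hD := finrank_le_finrank_map_fst_add_snd A.direction
  have hb₁ : Module.finrank (ZMod 2) (A.direction.map (LinearMap.fst (ZMod 2) V₁ V₂)) ≤ N₁ := Submodule.finrank_le _
  have hb₂ : Module.finrank (ZMod 2) (A.direction.map (LinearMap.snd (ZMod 2) V₁ V₂)) ≤ N₂ := Submodule.finrank_le _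
  omega

/-- **Product formula** («max flats of products are products»): the certificate codimension is additive on products. -/
theorem fcodim_product [Module.Finite (ZMod 2) V₁] [Module.Finite (ZMod 2) V₂] [DecidableEq V₁] [DecidableEq V₂]
    (Y₁ : Finset V₁) (Y₂ : Finset V₂) (y₁ : V₁) (y₂ : V₂) (hy₁ : y₁ ∈ Y₁) (hy₂ : y₂ ∈ Y₂) :
    fcodim (Module.finrank (ZMod 2) V₁ + Module.finrank (ZMod 2) V₂) (Y₁ ×ˢ Y₂) (y₁, y₂) =
      fcodim (Module.finrank (ZMod 2) V₁) Y₁ y₁ + fcodim (Module.finrank (ZMod 2) V₂) Y₂ y₂ :=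
  le_antisymm (fcodim_product_le _ _ Y₁ Y₂ y₁ y₂ hy₁ hy₂) (le_fcodim_product Y₁ Y₂ y₁ y₂ hy₁ hy₂)

/-! ## The total dimension of a product -/

/-- The total dimension `D(Y) = Σ_{y ∈ Y} (N − fcodim N Y y)` in a general ambient space (`= ClusCoord.dsum` on `𝔽₂^M`). -/
noncomputable def fdsum {V : Type*} [AddCommGroup V] [Module (ZMod 2) V] (N : ℕ) (Y : Finset V) : ℤ :=
  ∑ y ∈ Y, ((N : ℤ) - (fcodim N Y y : ℤ))

/-- `ClusCoord.dsum` is `fdsum` on `𝔽₂^M`. -/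
theorem dsum_eq_fdsum {M : ℕ} (Y : Finset (Fin M → ZMod 2)) : Summit.PneNP.PneNP.Theorems.ClusCoord.dsum M Y = fdsum M Y := rfl

/-- **`D(Y₁ × Y₂) = |Y₂|·D(Y₁) + |Y₁|·D(Y₂)`.** -/
theorem fdsum_product [Module.Finite (ZMod 2) V₁] [Module.Finite (ZMod 2) V₂] [DecidableEq V₁] [DecidableEq V₂]
    (Y₁ : Finset V₁) (Y₂ : Finset V₂) :
    fdsum (Module.finrank (ZMod 2) V₁ + Module.finrank (ZMod 2) V₂) (Y₁ ×ˢ Y₂) =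
      (Y₂.card : ℤ) * fdsum (Module.finrank (ZMod 2) V₁) Y₁ + (Y₁.card : ℤ) * fdsum (Module.finrank (ZMod 2) V₂) Y₂ := by
  unfold fdsum
  rw [Finset.sum_product]
  have h : ∀ y₁ ∈ Y₁, ∑ y₂ ∈ Y₂, (((Module.finrank (ZMod 2) V₁ + Module.finrank (ZMod 2) V₂ : ℕ) : ℤ) -
      (fcodim (Module.finrank (ZMod 2) V₁ + Module.finrank (ZMod 2) V₂) (Y₁ ×ˢ Y₂) (y₁, y₂) : ℤ)) =
      (Y₂.card : ℤ) * ((Module.finrank (ZMod 2) V₁ : ℤ) - (fcodim (Module.finrank (ZMod 2) V₁) Y₁ y₁ : ℤ)) +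
        ∑ y₂ ∈ Y₂, ((Module.finrank (ZMod 2) V₂ : ℤ) - (fcodim (Module.finrank (ZMod 2) V₂) Y₂ y₂ : ℤ)) := by
    intro y₁ hy₁
    calc ∑ y₂ ∈ Y₂, (((Module.finrank (ZMod 2) V₁ + Module.finrank (ZMod 2) V₂ : ℕ) : ℤ) -
          (fcodim (Module.finrank (ZMod 2) V₁ + Module.finrank (ZMod 2) V₂) (Y₁ ×ˢ Y₂) (y₁, y₂) : ℤ))
        = ∑ y₂ ∈ Y₂, (((Module.finrank (ZMod 2) V₁ : ℤ) - (fcodim (Module.finrank (ZMod 2) V₁) Y₁ y₁ : ℤ)) +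
            ((Module.finrank (ZMod 2) V₂ : ℤ) - (fcodim (Module.finrank (ZMod 2) V₂) Y₂ y₂ : ℤ))) := by
          refine Finset.sum_congr rfl fun y₂ hy₂ => ?_
          rw [fcodim_product Y₁ Y₂ y₁ y₂ hy₁ hy₂]
          push_cast
          ring
      _ = _ := by rw [Finset.sum_add_distrib, Finset.sum_const, nsmul_eq_mul]
  rw [Finset.sum_congr rfl h, Finset.sum_add_distrib, ← Finset.mul_sum, Finset.sum_const, nsmul_eq_mul]

end Summit.PneNP.PneNP.Theorems.ClusCoordProduct
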